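import Literature.AlgebraicGeometry.Motives.HodgeLieWeightOneIdealPairComponent
import HarnessLib

/-!
# Weight-one Hodge structures whose Hodge Lie algebra has a ONE-DIMENSIONAL positive part `𝔥⁺ = ℂE` (type-III-like
# position): `F E F ≠ 0`, `E F E = αE`, `F E F = αF`, the central element `(2P − 1)(1 − π)`, and `E F = αP`, `F E = α(1 − P)`
# when `𝔥_ℂ` has trivial centre

Family `hodge`, layer `Literature/AlgebraicGeometry/Motives`; THEOREMS ONLY (no definition, no named fact; D-0026).
Abstract groundwork for the `ℚ`-SIMPLE branch of the rung `dim MT(H¹X) = 7` of the cell `pub-hodgecm2` (COR-CM) lane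
MT-RANK-SEVEN-SPLIT, seat `b27` (`Summits/HodgeConjecture/CorCM/MumfordTateRankSevenSemisimple`): for a semisimple `𝔥` of
dimension `6` the `ad(2P − 1)`-grading `𝔥_ℂ = 𝔥⁻ ⊕ 𝔥⁰ ⊕ 𝔥⁺` has `dim 𝔥⁺ ∈ {1, 2}`; this file treats `dim 𝔥⁺ = 1`
(over `ℝ`: `Hg(ℝ) ~ SU₂ × SL₂(ℝ)`, `V_ℂ ≅ std ⊗ W` — the type III position), with no hypothesis on `dim 𝔥`.

SETTING.  `H` polarizable of weight `1` with polarization `ψ`, graded basis `e` with degrees in `{0,1}`, `P = gradingEnd e deg`,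
`𝔥 = Lie Hg(H)`, `𝔥_ℂ = H.hodgeLieC`, `X ∈ 𝔥 ∖ End_Hdg(V)`, `E = P X_ℂ (1 − P)`, `F = (1 − P) X_ℂ P`.  HYPOTHESES (§2 on):
`(h⁺)` every `P Y (1 − P)`, `Y ∈ 𝔥_ℂ`, is a multiple of `E`; `(h⁻)` every `(1 − P) Y P` is a multiple of `F` (the conjugate
of `(h⁺)`).

* §1 `projF_mul_projE_mul_projF_ne_zero` — **`F E F ≠ 0`** in general (second Hodge–Riemann relation at `u = F E w` with
  `conj u = E F conj w`; companion of `projF_mul_projE_ne_zero`).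
* §2 `exists_smul_of_plusLine` — **`E F E = αE`, `F E F = αF`, `α ≠ 0`**: `[[E,F],E] = 2EFE ∈ 𝔥⁺ = ℂE`,
  `[[E,F],F] = −2FEF ∈ 𝔥⁻ = ℂF`, the two constants agree (`F(EFE) = (FEF)E`, `FE ≠ 0`) and are non-zero by §1.  So
  `π = α⁻¹(EF + FE)` has all the identities of `idealProjector_identities`.
* §3 `commute_theta_mul_one_sub_projector_of_plusLine` — **`Z₀ = (2P − 1)(1 − π)` lies in `𝔥_ℂ` and commutes with
  `𝔥_ℂ`**: for `Y ∈ 𝔥_ℂ` the diagonal part `Y⁰ = Y − E_Y − F_Y` has `[Y⁰, E] = λE`, `[Y⁰, F] = μF` and `λ + μ = 0` (apply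
  `ad Y⁰` to `(EF)² = αEF`), so `Y⁰` commutes with `π`; `E`, `F` kill `1 − π` on both sides.
* §4 `projE_mul_projF_eq_smul_of_plusLine` — if moreover `𝔥_ℂ` has TRIVIAL CENTRE then `π = 1`: **`E F = αP`,
  `F E = α(1 − P)`** — the conclusion of the rank-three theorem `exists_projE_mul_projF_eq_smul` (`dim 𝔥 ≤ 3`) in the
  type-III position, without any bound on `dim 𝔥`: `V_ℂ = E V_ℂ ⊕ F V_ℂ`, i.e. `V_ℂ ≅ std ⊗ W` for the triple `(2P−1, E, F)`.

## References

* [MoonenZarhin1999LowDim] B. Moonen, Yu. Zarhin, *Hodge classes on abelian varieties of low dimension*, Math. Ann. 315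
  (1999), §2 (Hodge group, `Hg ⊆ Sp(ψ)`), (2.3) Type III.
* [Deligne1982HodgeCycles] P. Deligne, *Hodge cycles on abelian varieties*, LNM 900 (1982), I §3 (3.1–3.6).
* [FultonHarris1991] W. Fulton, J. Harris, *Representation Theory*, GTM 129 (1991), Lecture 11 (§11.1).
* [Huybrechts2016K3] D. Huybrechts, *Lectures on K3 Surfaces* (2016), Thm. 3.3.9 (proof, p. 67: `Hg ⊆ Sp(ψ)`).
-/

noncomputable section

open scoped TensorProduct

namespace Literature.AlgebraicGeometry.Motives

universe u

namespace HodgeStructure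

open ProjectorBlocks Literature.RepresentationTheory.GeneralLinear

variable {V : Type u} [AddCommGroup V] [Module ℚ V] [Module.Finite ℚ V] [HodgeTensorFacts.{u, u}] {n : ℤ}
  {S : Type u} [Fintype S] [DecidableEq S] {deg : S → ℤ}

/-! ## §1 `F E F ≠ 0` -/

/-- **`F E F ≠ 0`** for the blocks `E = P X_ℂ (1 − P)`, `F = (1 − P) X_ℂ P` of a rational `X ∈ 𝔥 ∖ End_Hdg(V)` (weight `1`,
degrees in `{0,1}`, `ψ` a polarization; no hypothesis on `dim 𝔥`): were `F E F = 0`, for `u = F E w ≠ 0` in `V^{0,1}` one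
gets `ψ_ℂ(u, ū) = ψ_ℂ(F E w, E F w̄) = −ψ_ℂ(E w, F E F w̄) = 0` (`F ∈ 𝔥_ℂ` is `ψ_ℂ`-skew, `conj` exchanges the blocks),
against the second Hodge–Riemann relation. [cite: MoonenZarhin1999LowDim, §2] [cite: Huybrechts2016K3, Thm. 3.3.9 (proof, p. 67)] -/
theorem projF_mul_projE_mul_projF_ne_zero (H : HodgeStructure V n) (ψ : H.Polarization) (hn : n = 1)
    (e : Module.Basis S ℂ (ℂ ⊗[ℚ] V)) (hF : ∀ a, H.F a = Submodule.span ℂ (e '' {σ | a ≤ deg σ}))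
    (hFc : ∀ a, complexConj (H.F a) = Submodule.span ℂ (e '' {σ | deg σ ≤ n - a}))
    (hdeg : ∀ σ, deg σ = 0 ∨ deg σ = 1) {X : Module.End ℚ V} (hX : X ∈ H.hodgeLie) (hXE : X ∉ H.endAlg) :
    ((1 - gradingEnd e deg) * X.baseChange ℂ * gradingEnd e deg) *
      (gradingEnd e deg * X.baseChange ℂ * (1 - gradingEnd e deg)) *
      ((1 - gradingEnd e deg) * X.baseChange ℂ * gradingEnd e deg) ≠ 0 := by
  classical
  have hFE0 := projF_mul_projE_ne_zero H ψ hn e hF hFc hdeg hX hXE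
  set P := gradingEnd e deg with hP
  set Y := X.baseChange ℂ with hY
  set E := P * Y * (1 - P) with hEdef
  set F := (1 - P) * Y * P with hFdef
  intro hFEF
  have hYM : Y ∈ H.hodgeLieC := H.baseChange_mem_hodgeLieC hX
  obtain ⟨-, hFM⟩ := projE_mem_hodgeLieC H e hF hFc hdeg hYM
  rw [← hP, ← hFdef] at hFM
  obtain ⟨w, hw⟩ : ∃ w, F (E w) ≠ 0 := by
    by_contra h
    push Not at h
    exact hFE0 (LinearMap.ext fun w => by rw [Module.End.mul_apply, h w, LinearMap.zero_apply])
  subst hn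
  have hmem : F (E w) ∈ H.piece 0 ((1 : ℤ) - 0) := by
    rw [piece_eq_span_of_graded H e hF hFc 0, hFdef, Module.End.mul_apply, Module.End.mul_apply]
    exact one_sub_gradingEnd_apply_mem_span_zero e hdeg _
  obtain ⟨r, hr, hre⟩ := ψ.pos 0 ((1 : ℤ) - 0) (by ring) (F (E w)) hmem hw
  have hconj1 : conj (F (E w)) = E (conj (E w)) := by
    have h := conj_projF_conj_apply H rfl e hF hFc X (conj (E w))
    rw [conj_conj] at h
    exact h
  have hconj2 : conj (E w) = F (conj w) := by
    have h := conj_projE_conj_apply H rfl e hF hFc X (conj w)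
    rw [conj_conj] at h
    exact h
  have h3 : F (E (F (conj w))) = (F * E * F) (conj w) := rfl
  have hzero : ψ.form.baseChange ℂ (F (E w)) (conj (F (E w))) = 0 := by
    rw [hconj1, hconj2, formBaseChange_skew_of_mem_hodgeLieC ψ hFM (E w) (E (F (conj w))), h3, hFEF,
      LinearMap.zero_apply, map_zero, neg_zero]
  rw [hzero, mul_zero] at hre
  have hr0 : (r : ℂ) = 0 := hre.symm
  exact hr.ne' (by exact_mod_cast hr0)

/-! ## §2 One-dimensional `𝔥⁺`: `E F E = αE`, `F E F = αF`, `α ≠ 0` -/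

/-- **`E F E = αE` and `F E F = αF` with `α ≠ 0` when `𝔥⁺ = ℂE` and `𝔥⁻ = ℂF`** (`X ∈ 𝔥 ∖ End_Hdg(V)`, weight `1`, `ψ` a
polarization): `[[E,F],E] = 2EFE` is an element of `𝔥_ℂ` of type `(1,−1)`, hence a multiple of `E`; likewise
`[[E,F],F] = −2FEF` is a multiple of `F`; the two constants agree since `F(EFE) = (FEF)E` and `FE ≠ 0`, and do not vanish by
`projF_mul_projE_mul_projF_ne_zero`. [cite: MoonenZarhin1999LowDim, §2 and (2.3)] [cite: FultonHarris1991, Lecture 11 (§11.1)] -/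
theorem exists_smul_of_plusLine (H : HodgeStructure V n) (ψ : H.Polarization) (hn : n = 1)
    (e : Module.Basis S ℂ (ℂ ⊗[ℚ] V)) (hF : ∀ a, H.F a = Submodule.span ℂ (e '' {σ | a ≤ deg σ}))
    (hFc : ∀ a, complexConj (H.F a) = Submodule.span ℂ (e '' {σ | deg σ ≤ n - a}))
    (hdeg : ∀ σ, deg σ = 0 ∨ deg σ = 1) {X : Module.End ℚ V} (hX : X ∈ H.hodgeLie) (hXE : X ∉ H.endAlg)
    (hplus : ∀ Y ∈ H.hodgeLieC, ∃ c : ℂ,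
      gradingEnd e deg * Y * (1 - gradingEnd e deg) = c • (gradingEnd e deg * X.baseChange ℂ * (1 - gradingEnd e deg)))
    (hminus : ∀ Y ∈ H.hodgeLieC, ∃ c : ℂ,
      (1 - gradingEnd e deg) * Y * gradingEnd e deg = c • ((1 - gradingEnd e deg) * X.baseChange ℂ * gradingEnd e deg)) :
    ∃ α : ℂ, α ≠ 0 ∧
      (gradingEnd e deg * X.baseChange ℂ * (1 - gradingEnd e deg)) *
          ((1 - gradingEnd e deg) * X.baseChange ℂ * gradingEnd e deg) *
          (gradingEnd e deg * X.baseChange ℂ * (1 - gradingEnd e deg)) =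
        α • (gradingEnd e deg * X.baseChange ℂ * (1 - gradingEnd e deg)) ∧
      ((1 - gradingEnd e deg) * X.baseChange ℂ * gradingEnd e deg) *
          (gradingEnd e deg * X.baseChange ℂ * (1 - gradingEnd e deg)) *
          ((1 - gradingEnd e deg) * X.baseChange ℂ * gradingEnd e deg) =
        α • ((1 - gradingEnd e deg) * X.baseChange ℂ * gradingEnd e deg) := by
  classical
  have hFE0 := projF_mul_projE_ne_zero H ψ hn e hF hFc hdeg hX hXE
  have hFEF0 := projF_mul_projE_mul_projF_ne_zero H ψ hn e hF hFc hdeg hX hXE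
  set P := gradingEnd e deg with hP
  set Y := X.baseChange ℂ with hY
  set E := P * Y * (1 - P) with hEdef
  set F := (1 - P) * Y * P with hFdef
  have hPP : P * P = P := gradingEnd_mul_gradingEnd_of_deg e hdeg
  have hPE : P * E = E := by rw [hEdef, ← mul_assoc, ← mul_assoc, hPP]
  have hEP : E * P = 0 := by rw [hEdef, mul_assoc (P * Y) (1 - P) P, sub_mul, one_mul, hPP, sub_self, mul_zero]
  have hPF : P * F = 0 := by
    rw [hFdef, mul_assoc (1 - P) Y P, ← mul_assoc P (1 - P) (Y * P), mul_sub, mul_one, hPP, sub_self, zero_mul]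
  have hFP : F * P = F := by rw [hFdef, mul_assoc ((1 - P) * Y) P P, hPP]
  have hEQ : E * (1 - P) = E := by rw [mul_sub, mul_one, hEP, sub_zero]
  have hQF : (1 - P) * F = F := by rw [sub_mul, one_mul, hPF, sub_zero]
  obtain ⟨hEE, hFF⟩ := SL2Triple.mul_self_eq_zero hPE hEP hPF hFP
  have hYM : Y ∈ H.hodgeLieC := H.baseChange_mem_hodgeLieC hX
  obtain ⟨hEM, hFM⟩ := projE_mem_hodgeLieC H e hF hFc hdeg hYM
  rw [← hP, ← hEdef] at hEM
  rw [← hP, ← hFdef] at hFM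
  have hBM : E * F - F * E ∈ H.hodgeLieC := H.commutator_mem_hodgeLieC hEM hFM
  clear_value P Y E F
  -- `[[E,F],E] = 2EFE ∈ 𝔥⁺`
  have hBE : (E * F - F * E) * E - E * (E * F - F * E) = (2 : ℂ) • (E * F * E) := by
    rw [sub_mul, mul_sub, mul_assoc F E E, hEE, mul_zero, sub_zero, ← mul_assoc E E F, hEE, zero_mul, zero_sub,
      ← mul_assoc E F E]
    module
  obtain ⟨c, hc⟩ := hplus _ (H.commutator_mem_hodgeLieC hBM hEM)
  rw [hBE, mul_smul_comm, smul_mul_assoc, ← mul_assoc P (E * F) E, ← mul_assoc P E F, hPE, mul_assoc (E * F) E (1 - P),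
    hEQ] at hc
  -- `[[E,F],F] = −2FEF ∈ 𝔥⁻`
  have hBF : (E * F - F * E) * F - F * (E * F - F * E) = (-2 : ℂ) • (F * E * F) := by
    rw [sub_mul, mul_sub, mul_assoc E F F, hFF, mul_zero, zero_sub, ← mul_assoc F F E, hFF, zero_mul, sub_zero,
      ← mul_assoc F E F]
    module
  obtain ⟨c', hc'⟩ := hminus _ (H.commutator_mem_hodgeLieC hBM hFM)
  rw [hBF, mul_smul_comm, smul_mul_assoc, ← mul_assoc (1 - P) (F * E) F, ← mul_assoc (1 - P) F E, hQF,
    mul_assoc (F * E) F P, hFP] at hc'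
  -- the constants: `EFE = (c/2) E`, `FEF = (-c'/2) F`
  have hEFE : E * F * E = ((2 : ℂ)⁻¹ * c) • E := by
    have h := congrArg (fun T : Module.End ℂ (ℂ ⊗[ℚ] V) => (2 : ℂ)⁻¹ • T) hc
    simp only [smul_smul, inv_mul_cancel₀ (two_ne_zero' ℂ), one_smul] at h
    exact h
  have hFEF : F * E * F = ((-2 : ℂ)⁻¹ * c') • F := by
    have h := congrArg (fun T : Module.End ℂ (ℂ ⊗[ℚ] V) => (-2 : ℂ)⁻¹ • T) hc'
    simp only [smul_smul, inv_mul_cancel₀ (show (-2 : ℂ) ≠ 0 by norm_num), one_smul] at h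
    exact h
  -- they agree: `F (EFE) = (FEF) E`
  have heq : (2 : ℂ)⁻¹ * c = (-2 : ℂ)⁻¹ * c' := by
    have h1 : F * (E * F * E) = ((2 : ℂ)⁻¹ * c) • (F * E) := by rw [hEFE, mul_smul_comm]
    have h2 : F * (E * F * E) = ((-2 : ℂ)⁻¹ * c') • (F * E) := by
      rw [← mul_assoc F (E * F) E, ← mul_assoc F E F, hFEF, smul_mul_assoc]
    exact smul_left_injective ℂ hFE0 (h1.symm.trans h2)
  refine ⟨(2 : ℂ)⁻¹ * c, ?_, hEFE, by rw [heq]; exact hFEF⟩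
  intro h0
  apply hFEF0
  rw [hFEF, ← heq, h0, zero_smul]

/-! ## §3 The central element `(2P − 1)(1 − π)` -/

/-- **`Z₀ = (2P − 1)(1 − π)` lies in `𝔥_ℂ` and commutes with every element of `𝔥_ℂ`**, for `π = α⁻¹(EF + FE)` with
`E F E = αE`, `F E F = αF`, `α ≠ 0`, under `𝔥⁺ = ℂE`, `𝔥⁻ = ℂF`.  PROOF: `(2P−1)π = α⁻¹[E,F] ∈ 𝔥_ℂ`; `E`, `F` kill `1 − π` on
both sides; for `Y ∈ 𝔥_ℂ` the diagonal part `Y⁰ = Y − E_Y − F_Y` (`E_Y ∈ ℂE`, `F_Y ∈ ℂF`) satisfies `[Y⁰, E] = λE`,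
`[Y⁰, F] = μF`, and applying `ad Y⁰` to `(EF)² = αEF` gives `λ + μ = 0`, so `Y⁰` commutes with `EF`, `FE`, `π` and `2P − 1`.
[cite: MoonenZarhin1999LowDim, §2 and (2.3)] [cite: FultonHarris1991, Lecture 11 (§11.1)] -/
theorem commute_theta_mul_one_sub_projector_of_plusLine (H : HodgeStructure V n) (ψ : H.Polarization) (hn : n = 1)
    (e : Module.Basis S ℂ (ℂ ⊗[ℚ] V)) (hF : ∀ a, H.F a = Submodule.span ℂ (e '' {σ | a ≤ deg σ}))
    (hFc : ∀ a, complexConj (H.F a) = Submodule.span ℂ (e '' {σ | deg σ ≤ n - a}))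
    (hdeg : ∀ σ, deg σ = 0 ∨ deg σ = 1) {X : Module.End ℚ V} (hX : X ∈ H.hodgeLie) (hXE : X ∉ H.endAlg)
    (hplus : ∀ Y ∈ H.hodgeLieC, ∃ c : ℂ,
      gradingEnd e deg * Y * (1 - gradingEnd e deg) = c • (gradingEnd e deg * X.baseChange ℂ * (1 - gradingEnd e deg)))
    (hminus : ∀ Y ∈ H.hodgeLieC, ∃ c : ℂ,
      (1 - gradingEnd e deg) * Y * gradingEnd e deg = c • ((1 - gradingEnd e deg) * X.baseChange ℂ * gradingEnd e deg))
    {α : ℂ} (hα : α ≠ 0)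
    (hEFE : (gradingEnd e deg * X.baseChange ℂ * (1 - gradingEnd e deg)) *
        ((1 - gradingEnd e deg) * X.baseChange ℂ * gradingEnd e deg) *
        (gradingEnd e deg * X.baseChange ℂ * (1 - gradingEnd e deg)) =
      α • (gradingEnd e deg * X.baseChange ℂ * (1 - gradingEnd e deg)))
    (hFEF : ((1 - gradingEnd e deg) * X.baseChange ℂ * gradingEnd e deg) *
        (gradingEnd e deg * X.baseChange ℂ * (1 - gradingEnd e deg)) *
        ((1 - gradingEnd e deg) * X.baseChange ℂ * gradingEnd e deg) =
      α • ((1 - gradingEnd e deg) * X.baseChange ℂ * gradingEnd e deg))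
    {Q : Module.End ℂ (ℂ ⊗[ℚ] V)}
    (hQ : Q = α⁻¹ • ((gradingEnd e deg * X.baseChange ℂ * (1 - gradingEnd e deg)) *
          ((1 - gradingEnd e deg) * X.baseChange ℂ * gradingEnd e deg) +
        ((1 - gradingEnd e deg) * X.baseChange ℂ * gradingEnd e deg) *
          (gradingEnd e deg * X.baseChange ℂ * (1 - gradingEnd e deg)))) :
    ((2 : ℂ) • gradingEnd e deg - 1) * (1 - Q) ∈ H.hodgeLieC ∧
      ∀ Y ∈ H.hodgeLieC, ((2 : ℂ) • gradingEnd e deg - 1) * (1 - Q) * Y = Y * (((2 : ℂ) • gradingEnd e deg - 1) * (1 - Q)) := by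
  classical
  subst hn
  obtain ⟨hE0, hF0⟩ := projE_ne_zero_of_not_mem_endAlg H rfl e hF hFc hdeg hXE
  obtain ⟨hQQ, hPQ, -, hEQ', hQE, hFQ', hQF', hΘQ, -, -, -⟩ := idealProjector_identities e hdeg X hα hEFE hFEF hQ
  set P := gradingEnd e deg with hP
  set Yx := X.baseChange ℂ with hY
  set E := P * Yx * (1 - P) with hEdef
  set F := (1 - P) * Yx * P with hFdef
  have hPP : P * P = P := gradingEnd_mul_gradingEnd_of_deg e hdeg
  have hPE : P * E = E := by rw [hEdef, ← mul_assoc, ← mul_assoc, hPP]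
  have hEP : E * P = 0 := by rw [hEdef, mul_assoc (P * Yx) (1 - P) P, sub_mul, one_mul, hPP, sub_self, mul_zero]
  have hPF : P * F = 0 := by
    rw [hFdef, mul_assoc (1 - P) Yx P, ← mul_assoc P (1 - P) (Yx * P), mul_sub, mul_one, hPP, sub_self, zero_mul]
  have hFP : F * P = F := by rw [hFdef, mul_assoc ((1 - P) * Yx) P P, hPP]
  have hEQ : E * (1 - P) = E := by rw [mul_sub, mul_one, hEP, sub_zero]
  have hQF : (1 - P) * F = F := by rw [sub_mul, one_mul, hPF, sub_zero]
  have hYM : Yx ∈ H.hodgeLieC := H.baseChange_mem_hodgeLieC hX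
  obtain ⟨hEM, hFM⟩ := projE_mem_hodgeLieC H e hF hFc hdeg hYM
  rw [← hP, ← hEdef] at hEM
  rw [← hP, ← hFdef] at hFM
  have hΘ' : (2 : ℂ) • P - 1 ∈ H.hodgeLieC := by
    simpa only [Int.cast_one, one_smul] using two_smul_gradingEnd_sub_mem_hodgeLieC H e hF hFc
  obtain ⟨hΘE, hΘF⟩ := theta_bracket hPE hEP hPF hFP
  clear_value P Yx E F
  obtain ⟨Θ', hΘ'def⟩ : ∃ T : Module.End ℂ (ℂ ⊗[ℚ] V), T = (2 : ℂ) • P - 1 := ⟨_, rfl⟩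
  rw [← hΘ'def] at hΘ' hΘE hΘF hΘQ ⊢
  have hΘΘ : Θ' * Θ' = 1 := by rw [hΘ'def]; exact theta_mul_theta hPP
  -- membership: `Θ'(1 − Q) = Θ' − α⁻¹[E,F]`
  have hmemZ : Θ' * (1 - Q) ∈ H.hodgeLieC := by
    rw [mul_sub, mul_one, hΘQ]
    exact H.hodgeLieC.sub_mem hΘ' (H.hodgeLieC.smul_mem _ (H.commutator_mem_hodgeLieC hEM hFM))
  refine ⟨hmemZ, fun Y hYh => ?_⟩
  -- decompose `Y = Y⁰ + cE + c'F`
  obtain ⟨c, hc⟩ := hplus Y hYh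
  obtain ⟨c', hc'⟩ := hminus Y hYh
  obtain ⟨Y0, hY0def⟩ : ∃ T : Module.End ℂ (ℂ ⊗[ℚ] V), T = Y - c • E - c' • F := ⟨_, rfl⟩
  have hYdec : Y = Y0 + c • E + c' • F := by rw [hY0def]; abel
  -- `Y⁰` commutes with `P`
  have h1 : Y0 * P = P * (Y * P) := by
    rw [hY0def, sub_mul, sub_mul, smul_mul_assoc, smul_mul_assoc, hEP, hFP, smul_zero, sub_zero, ← hc',
      mul_assoc (1 - P) Y P, sub_mul, one_mul, sub_sub_cancel]
  have h2 : P * Y0 = P * (Y * P) := by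
    rw [hY0def, mul_sub, mul_sub, mul_smul_comm, mul_smul_comm, hPE, hPF, smul_zero, sub_zero, ← hc, mul_sub, mul_one,
      sub_sub_cancel, mul_assoc]
  have hY0P : Y0 * P = P * Y0 := by rw [h1, h2]
  have hY0Q1 : Y0 * (1 - P) = (1 - P) * Y0 := by rw [mul_sub, sub_mul, mul_one, one_mul, hY0P]
  have hY0M : Y0 ∈ H.hodgeLieC := by
    rw [hY0def]
    exact H.hodgeLieC.sub_mem (H.hodgeLieC.sub_mem hYh (H.hodgeLieC.smul_mem _ hEM)) (H.hodgeLieC.smul_mem _ hFM)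
  -- `[Y⁰, E] = λE`, `[Y⁰, F] = μF`
  obtain ⟨lam, hlam⟩ := hplus _ (H.commutator_mem_hodgeLieC hY0M hEM)
  have keyE : P * (Y0 * E - E * Y0) * (1 - P) = Y0 * E - E * Y0 := by
    rw [mul_sub P (Y0 * E) (E * Y0), sub_mul (P * (Y0 * E)) (P * (E * Y0)) (1 - P), ← mul_assoc P Y0 E, ← hY0P,
      mul_assoc Y0 P E, hPE, mul_assoc Y0 E (1 - P), hEQ, ← mul_assoc P E Y0, hPE, mul_assoc E Y0 (1 - P), hY0Q1,
      ← mul_assoc E (1 - P) Y0, hEQ]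
  have hY0E : Y0 * E - E * Y0 = lam • E := by rw [← keyE]; exact hlam
  obtain ⟨mu, hmu⟩ := hminus _ (H.commutator_mem_hodgeLieC hY0M hFM)
  have keyF : (1 - P) * (Y0 * F - F * Y0) * P = Y0 * F - F * Y0 := by
    rw [mul_sub (1 - P) (Y0 * F) (F * Y0), sub_mul ((1 - P) * (Y0 * F)) ((1 - P) * (F * Y0)) P,
      ← mul_assoc (1 - P) Y0 F, ← hY0Q1, mul_assoc Y0 (1 - P) F, hQF, mul_assoc Y0 F P, hFP,
      ← mul_assoc (1 - P) F Y0, hQF, mul_assoc F Y0 P, hY0P, ← mul_assoc F P Y0, hFP]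
  have hY0F : Y0 * F - F * Y0 = mu • F := by rw [← keyF]; exact hmu
  -- `λ + μ = 0`: apply `ad Y⁰` to `(EF)² = α EF`
  have hEF0 : E * F ≠ 0 := by
    intro h0
    apply hE0
    have h := hEFE
    rw [h0, zero_mul] at h
    exact (smul_eq_zero.1 h.symm).resolve_left hα
  have hEFEF : E * F * (E * F) = α • (E * F) := by rw [← mul_assoc, hEFE, smul_mul_assoc]
  have hY0EF : Y0 * (E * F) - E * F * Y0 = (lam + mu) • (E * F) := by
    have h : Y0 * (E * F) - E * F * Y0 = (Y0 * E - E * Y0) * F + E * (Y0 * F - F * Y0) := by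
      simp only [sub_mul, mul_sub, mul_assoc]; abel
    rw [h, hY0E, hY0F, smul_mul_assoc, mul_smul_comm, add_smul]
  have hlm : lam + mu = 0 := by
    have h1 : Y0 * (E * F * (E * F)) - E * F * (E * F) * Y0 = ((2 : ℂ) * ((lam + mu) * α)) • (E * F) := by
      have h : Y0 * (E * F * (E * F)) - E * F * (E * F) * Y0 =
          (Y0 * (E * F) - E * F * Y0) * (E * F) + E * F * (Y0 * (E * F) - E * F * Y0) := by
        simp only [sub_mul, mul_sub, mul_assoc]; abel
      rw [h, hY0EF, smul_mul_assoc, mul_smul_comm, hEFEF, smul_smul, ← add_smul, two_mul]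
    have hY0EF2 : Y0 * (E * F) = E * F * Y0 + (lam + mu) • (E * F) := by rw [← hY0EF]; abel
    have h2 : Y0 * (E * F * (E * F)) - E * F * (E * F) * Y0 = ((lam + mu) * α) • (E * F) := by
      rw [hEFEF, mul_smul_comm, smul_mul_assoc, hY0EF2, smul_add, add_sub_cancel_left, smul_smul, mul_comm α]
    have hcoef : (2 : ℂ) * ((lam + mu) * α) = (lam + mu) * α := smul_left_injective ℂ hEF0 (h1.symm.trans h2)
    have : (lam + mu) * α = 0 := by linear_combination hcoef
    exact (mul_eq_zero.1 this).resolve_right hα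
  -- `Y⁰` commutes with `EF`, `FE`, hence with `Q` and with `Θ'`
  have hY0EF' : Y0 * (E * F) = E * F * Y0 := by
    rw [← sub_eq_zero, hY0EF, hlm, zero_smul]
  have hY0FE' : Y0 * (F * E) = F * E * Y0 := by
    have h : Y0 * (F * E) - F * E * Y0 = (Y0 * F - F * Y0) * E + F * (Y0 * E - E * Y0) := by
      simp only [sub_mul, mul_sub, mul_assoc]; abel
    rw [← sub_eq_zero, h, hY0F, hY0E, smul_mul_assoc, mul_smul_comm, ← add_smul, add_comm, hlm, zero_smul]
  have hY0Q : Y0 * Q = Q * Y0 := by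
    rw [hQ, mul_smul_comm, smul_mul_assoc, mul_add, add_mul, hY0EF', hY0FE']
  have hY0Θ : Y0 * Θ' = Θ' * Y0 := by
    rw [hΘ'def, mul_sub, sub_mul, mul_one, one_mul, mul_smul_comm, smul_mul_assoc, hY0P]
  -- `E`, `F` kill `Z₀ = Θ'(1 − Q)` on both sides
  have h1QE : (1 - Q) * E = 0 := by rw [sub_mul, one_mul, hQE, sub_self]
  have h1QF : (1 - Q) * F = 0 := by rw [sub_mul, one_mul, hQF', sub_self]
  have hE1Q : E * (1 - Q) = 0 := by rw [mul_sub, mul_one, hEQ', sub_self]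
  have hF1Q : F * (1 - Q) = 0 := by rw [mul_sub, mul_one, hFQ', sub_self]
  have hZE : Θ' * (1 - Q) * E = 0 := by rw [mul_assoc, h1QE, mul_zero]
  have hZF : Θ' * (1 - Q) * F = 0 := by rw [mul_assoc, h1QF, mul_zero]
  have hEZ : E * (Θ' * (1 - Q)) = 0 := by
    have hEΘ : E * Θ' = Θ' * E - (2 : ℂ) • E := by rw [← hΘE]; abel
    rw [← mul_assoc, hEΘ, sub_mul, smul_mul_assoc, mul_assoc, hE1Q, mul_zero, smul_zero, sub_zero]
  have hFZ : F * (Θ' * (1 - Q)) = 0 := by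
    have hFΘ : F * Θ' = Θ' * F + (2 : ℂ) • F := by rw [← sub_sub_cancel (Θ' * F) (F * Θ'), hΘF]; abel
    rw [← mul_assoc, hFΘ, add_mul, smul_mul_assoc, mul_assoc, hF1Q, mul_zero, smul_zero, add_zero]
  have hY01Q : (1 - Q) * Y0 = Y0 * (1 - Q) := by rw [sub_mul, mul_sub, one_mul, mul_one, hY0Q]
  have hY0Z : Θ' * (1 - Q) * Y0 = Y0 * (Θ' * (1 - Q)) := by
    rw [mul_assoc, hY01Q, ← mul_assoc, ← hY0Θ, mul_assoc]
  rw [hYdec, mul_add, mul_add, add_mul, add_mul, mul_smul_comm, mul_smul_comm, smul_mul_assoc, smul_mul_assoc, hZE, hZF,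
    hEZ, hFZ, hY0Z]

/-! ## §4 Trivial centre: `π = 1`, `E F = αP`, `F E = α(1 − P)` -/

/-- **`E F = αP` and `F E = α(1 − P)` when `𝔥⁺ = ℂE`, `𝔥⁻ = ℂF` and `𝔥_ℂ` has TRIVIAL CENTRE** (every element of `𝔥_ℂ`
commuting with `𝔥_ℂ` vanishes — e.g. `𝔥` semisimple): the central element `(2P − 1)(1 − π)` of §3 vanishes, so `1 − π =
(2P−1)²(1 − π) = 0`, `E F + F E = α` and its two corners are `E F = αP`, `F E = α(1 − P)` — the conclusion of the rank-three
theorem `exists_projE_mul_projF_eq_smul` in the type-III position (`V_ℂ = E V_ℂ ⊕ F V_ℂ ≅ std ⊗ W`).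
[cite: MoonenZarhin1999LowDim, §2 and (2.3)] [cite: FultonHarris1991, Lecture 11 (§11.1)] -/
theorem projE_mul_projF_eq_smul_of_plusLine (H : HodgeStructure V n) (ψ : H.Polarization) (hn : n = 1)
    (e : Module.Basis S ℂ (ℂ ⊗[ℚ] V)) (hF : ∀ a, H.F a = Submodule.span ℂ (e '' {σ | a ≤ deg σ}))
    (hFc : ∀ a, complexConj (H.F a) = Submodule.span ℂ (e '' {σ | deg σ ≤ n - a}))
    (hdeg : ∀ σ, deg σ = 0 ∨ deg σ = 1) {X : Module.End ℚ V} (hX : X ∈ H.hodgeLie) (hXE : X ∉ H.endAlg)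
    (hplus : ∀ Y ∈ H.hodgeLieC, ∃ c : ℂ,
      gradingEnd e deg * Y * (1 - gradingEnd e deg) = c • (gradingEnd e deg * X.baseChange ℂ * (1 - gradingEnd e deg)))
    (hminus : ∀ Y ∈ H.hodgeLieC, ∃ c : ℂ,
      (1 - gradingEnd e deg) * Y * gradingEnd e deg = c • ((1 - gradingEnd e deg) * X.baseChange ℂ * gradingEnd e deg))
    (hcent : ∀ W ∈ H.hodgeLieC, (∀ Y ∈ H.hodgeLieC, W * Y = Y * W) → W = 0) :
    ∃ α : ℂ, α ≠ 0 ∧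
      (gradingEnd e deg * X.baseChange ℂ * (1 - gradingEnd e deg)) *
          ((1 - gradingEnd e deg) * X.baseChange ℂ * gradingEnd e deg) = α • gradingEnd e deg ∧
      ((1 - gradingEnd e deg) * X.baseChange ℂ * gradingEnd e deg) *
          (gradingEnd e deg * X.baseChange ℂ * (1 - gradingEnd e deg)) = α • (1 - gradingEnd e deg) ∧
      (gradingEnd e deg * X.baseChange ℂ * (1 - gradingEnd e deg)) *
            ((1 - gradingEnd e deg) * X.baseChange ℂ * gradingEnd e deg) +
          ((1 - gradingEnd e deg) * X.baseChange ℂ * gradingEnd e deg) *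
            (gradingEnd e deg * X.baseChange ℂ * (1 - gradingEnd e deg)) = α • 1 := by
  classical
  obtain ⟨α, hα, hEFE, hFEF⟩ := exists_smul_of_plusLine H ψ hn e hF hFc hdeg hX hXE hplus hminus
  obtain ⟨hZ, hZc⟩ := commute_theta_mul_one_sub_projector_of_plusLine H ψ hn e hF hFc hdeg hX hXE hplus hminus hα
    hEFE hFEF rfl
  obtain ⟨-, -, hPQ', -, -, -, -, -, -, -, -⟩ := idealProjector_identities e hdeg X hα hEFE hFEF rfl
  set P := gradingEnd e deg with hP
  set Yx := X.baseChange ℂ with hY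
  set E := P * Yx * (1 - P) with hEdef
  set F := (1 - P) * Yx * P with hFdef
  set Q : Module.End ℂ (ℂ ⊗[ℚ] V) := α⁻¹ • (E * F + F * E) with hQdef
  have hPP : P * P = P := gradingEnd_mul_gradingEnd_of_deg e hdeg
  have hZ0 : ((2 : ℂ) • P - 1) * (1 - Q) = 0 := hcent _ hZ hZc
  have hQ1 : Q = 1 := by
    have h := congrArg (fun T => ((2 : ℂ) • P - 1) * T) hZ0
    simp only [← mul_assoc, theta_mul_theta hPP, one_mul, mul_zero] at h
    exact (sub_eq_zero.1 h).symm
  have hsum : E * F + F * E = α • (1 : Module.End ℂ (ℂ ⊗[ℚ] V)) := by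
    have h : α • Q = E * F + F * E := by rw [hQdef, smul_smul, mul_inv_cancel₀ hα, one_smul]
    rw [← h, hQ1]
  rw [hQ1, mul_one] at hPQ'
  have hEF : E * F = α • P := by rw [hPQ', smul_smul, mul_inv_cancel₀ hα, one_smul]
  refine ⟨α, hα, hEF, ?_, hsum⟩
  have h2 : F * E = α • (1 : Module.End ℂ (ℂ ⊗[ℚ] V)) - E * F := by rw [← hsum]; abel
  rw [h2, hEF, smul_sub]

end HodgeStructure

end Literature.AlgebraicGeometry.Motives

end
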